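import Literature.NumberTheory.EllipticCurves.ZpExtensionShapiroToEisensteinLocalConditionsProofs
import Literature.NumberTheory.EllipticCurves.ZpExtensionShapiroSetting
import HarnessLib

/-!
# Howard's Lemma 2.2.7 for lit's SHIFTED Shapiro tower: the level maps `f_{i+1,k}` carry `𝓕_Λ` of the shifted source
# (`coeffSelmerStructure` on the families `j ↦ E[p^{j+1}]`, `(ω_{j+1}, p^{j+1})`, ordinary data `Φ.succ`; tower level `i` =
# Shapiro level `i+1`) into `F_𝔮` (D1's `eisensteinSelmerStructure`, level `k`) at EVERY place (theorems only)

Topic `NumberTheory/EllipticCurves` (sequel of `ZpExtensionShapiroToEisensteinLocalConditionsProofs` (G4b-2), `…LocalTrianglesProofs`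
(G4b-1), `TowerExactFamiliesTransferProofs` (G4a), and lit's `ZpExtensionShapiroSetting` (A2: `shapiroTower`, `OrdinaryFiltration.succ`)).
Cell `pub/bsd-print-x9`, seat `bsd-line-x9-p2` g4, STUB A of the shared μ-crux: the `cond_le` field of the ONE
`CoeffTowerSetting.Hom` from lit's `S_Λ = shapiroSettingTame …` (whose tower is the SHIFTED `coeffAdicTower`, level `j` = Shapiro
level `j+1`, A2) into D1's Eisenstein DVR setting.

Why a separate file (and not G4b-2 ∘ «shifted ≤ unshifted»): the shifted and the unshifted `Λ`-adic towers have definitionally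
equal levels (`𝐓_j = E[p^{j+1}] ⊗ Λ/(ω_{j+1},p^{j+1})`), but every identification of a shifted tower object with the unshifted one a
level up costs the elaborator a failed structure comparison per wrapper layer (measured: one `coeffLocalRed` identification exceeds
the default heartbeat budget).  So G4b-2 is REPLAYED on the shifted parameters: the carriers-level triangles (T1)/(T2) of G4b-1 are
reused verbatim (they live on `E[p^σ] ⊗ Λ/(ω_σ, p^σ)`, `σ = i+1`), only their local-`H¹` forms, the cores lemma and the three
clauses are restated on the shifted tower; the proofs are those of G4b-1/G4b-2 word for word.
* §1 local forms on the shifted tower: (T1) `H¹(f_{i+1,k}) ∘ coeffLocalRed_i = H¹(f_{i+2,k})`, (T2), cores `↦` cores (`Φ.succ` at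
  tower level `i` is `Fil_v E[p^{i+1}]`), unramified `↦` unramified;
* §2 Lemma 2.2.7 at `v ∣ p`, at `v ∈ S ∖ {p}` (given the (N1) torsion bound `hS`), elsewhere, and at all places:
  **`map_coeffSelmerStructure_succ_le_eisensteinSelmerStructure`**;
* §3 the bridge to the `ContinuousRep.cohomologyMap` spelling of `Hom.cond_le` for the additive level map
  `shapiroToEisensteinLevelMap (i+1) k` on the shifted level synonym.
Theorems only; no named fact, no instance, no notation, no `sorry`.  BSD is not proved by any of this.

References: [Howard2004HeegnerKolyvagin] Rem. 1.2.4, Lemma 2.2.7, Def. 2.2.5–2.2.6, proof of Thm. 2.2.10 (arXiv p. 7 L13–27, p0016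
L84–148, p0017 L78–81); [CastellaGrossiLeeSkinner2022] §3.4 (𝓕_Λ; arXiv v2 TeX L2102–2108); [SerreGaloisCohomology1997] I §2.2, §2.4, II §6.1.
-/

noncomputable section

open scoped TensorProduct Topology Classical ContRepresentation
open Field CategoryTheory IsLocalRing IsDedekindDomain
open scoped NumberField

namespace Literature.NumberTheory.EllipticCurves.ZpExtension

open Literature.NumberTheory.GaloisRepresentations
open Literature.NumberTheory.GaloisRepresentations.DiscreteGaloisModule (SelmerStructure)
open Literature.NumberTheory.GaloisCohomology.Howard2004

variable {K : Type} [Field K] [NumberField K] {V : WeierstrassCurve K} {p : ℕ} [hp : Fact p.Prime] (κ : ZpExtension K p)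
  (t : ∀ k, (V.torsionGaloisModule ((p : ℤ) ^ (k + 1))).toContRepresentation →ⁱL
    (V.torsionGaloisModule ((p : ℤ) ^ k)).toContRepresentation)
  (ht : ∀ k (P : WeierstrassCurve.geomTorsion V ((p : ℤ) ^ (k + 1))), t k P = V.geomTorsionReduce p k P)
  (hts : ∀ k, Function.Surjective (t k)) {m : ℕ} (hm : 1 ≤ m)

/-! ## §1 The local `H¹` forms on the SHIFTED tower -/

include ht in
/-- **(T1) on local `H¹`, shifted tower**: `H¹(K_v, f_{i+1,k}) ∘ (𝐓_{i+1} → 𝐓_i on H¹(K_v, ·)) = H¹(K_v, f_{i+2,k})`.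
[cite: SerreGaloisCohomology1997, I §2.2 and §2.4] [cite: Howard2004HeegnerKolyvagin, Rem. 1.2.4 and Lemma 2.2.7] -/
theorem map_localMap_shapiroToEisensteinTwistLe_coeffLocalRed_succ (v : NumberField.Place K) (i k : ℕ) (hσ : k ≤ i + 1)
    (hσ' : k ≤ i + 1 + 1)
    (hle : shapiroIdeal p (i + 1) ≤ Ideal.span {(PowerSeries.X ^ m + PowerSeries.C (p : ℤ_[p]) : IwasawaAlgebra p)} ⊔
      Ideal.span {PowerSeries.C ((p : ℤ_[p]) ^ k)})
    (hle' : shapiroIdeal p (i + 1 + 1) ≤ Ideal.span {(PowerSeries.X ^ m + PowerSeries.C (p : ℤ_[p]) : IwasawaAlgebra p)} ⊔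
      Ideal.span {PowerSeries.C ((p : ℤ_[p]) ^ k)})
    (y : galoisCohomology (((κ.coeffAdicTower (fun j ↦ V.torsionGaloisModule ((p : ℤ) ^ (j + 1))) (fun j ↦ t (j + 1))
      (fun j ↦ shapiroIdeal p (j + 1)) (fun j ↦ shapiroIdeal_succ_le p (j + 1)) (fun j ↦ j + 1) (fun j ↦ omega_mem_shapiroIdeal p (j + 1))
      (fun j ↦ (j + 1) * p ^ (j + 1) + (j + 1)) (fun j ↦ maximalIdeal_pow_le_shapiroIdeal p (j + 1)) (fun j ↦ hts (j + 1))).ρ (i + 1)).toLocal v) 1) :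
    galoisCohomology.map (DiscreteGaloisModule.localMap (κ.shapiroToEisensteinTwistLe V hm (i + 1) k hσ hle) v) 1
        (κ.coeffLocalRed (fun j ↦ V.torsionGaloisModule ((p : ℤ) ^ (j + 1))) (fun j ↦ t (j + 1))
      (fun j ↦ shapiroIdeal p (j + 1)) (fun j ↦ shapiroIdeal_succ_le p (j + 1)) (fun j ↦ j + 1) (fun j ↦ omega_mem_shapiroIdeal p (j + 1))
      (fun j ↦ (j + 1) * p ^ (j + 1) + (j + 1)) (fun j ↦ maximalIdeal_pow_le_shapiroIdeal p (j + 1)) (fun j ↦ hts (j + 1)) v i y) =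
      galoisCohomology.map (DiscreteGaloisModule.localMap (κ.shapiroToEisensteinTwistLe V hm (i + 1 + 1) k hσ' hle') v) 1 y := by
  rw [coeffLocalRed]
  exact galoisCohomology.map_map_of_comp_apply
    (DiscreteGaloisModule.localMap (κ.coeffLevelReduce (fun j ↦ V.torsionGaloisModule ((p : ℤ) ^ (j + 1))) (fun j ↦ t (j + 1))
      (fun j ↦ shapiroIdeal p (j + 1)) (fun j ↦ shapiroIdeal_succ_le p (j + 1)) (fun j ↦ j + 1) (fun j ↦ omega_mem_shapiroIdeal p (j + 1)) i) v)
    (DiscreteGaloisModule.localMap (κ.shapiroToEisensteinTwistLe V hm (i + 1) k hσ hle) v)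
    (DiscreteGaloisModule.localMap (κ.shapiroToEisensteinTwistLe V hm (i + 1 + 1) k hσ' hle') v)
    (fun x ↦ (κ.shapiroToEisensteinTwistLe_coeffLevelReduce t ht hm (i + 1) k hσ hσ' hle hle' x).symm) y

include ht in
/-- **(T2) on local `H¹`, source classes on the shifted tower**: `(H¹(K_v, W_{k+1}) → H¹(K_v, W_k)) ∘ H¹(K_v, f_{i+1,k+1}) =
H¹(K_v, f_{i+1,k})`. [cite: SerreGaloisCohomology1997, I §2.2 and §2.4] [cite: Howard2004HeegnerKolyvagin, Rem. 1.2.4 and Lemma 2.2.7] -/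
theorem eisensteinLocalReduce_map_localMap_shapiroToEisensteinTwistLe_succ (v : NumberField.Place K) (i k : ℕ)
    (hσ : k + 1 ≤ i + 1) (hσ' : k ≤ i + 1)
    (hle : shapiroIdeal p (i + 1) ≤ Ideal.span {(PowerSeries.X ^ m + PowerSeries.C (p : ℤ_[p]) : IwasawaAlgebra p)} ⊔
      Ideal.span {PowerSeries.C ((p : ℤ_[p]) ^ (k + 1))})
    (hle' : shapiroIdeal p (i + 1) ≤ Ideal.span {(PowerSeries.X ^ m + PowerSeries.C (p : ℤ_[p]) : IwasawaAlgebra p)} ⊔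
      Ideal.span {PowerSeries.C ((p : ℤ_[p]) ^ k)})
    (y : galoisCohomology (((κ.coeffAdicTower (fun j ↦ V.torsionGaloisModule ((p : ℤ) ^ (j + 1))) (fun j ↦ t (j + 1))
      (fun j ↦ shapiroIdeal p (j + 1)) (fun j ↦ shapiroIdeal_succ_le p (j + 1)) (fun j ↦ j + 1) (fun j ↦ omega_mem_shapiroIdeal p (j + 1))
      (fun j ↦ (j + 1) * p ^ (j + 1) + (j + 1)) (fun j ↦ maximalIdeal_pow_le_shapiroIdeal p (j + 1)) (fun j ↦ hts (j + 1))).ρ i).toLocal v) 1) :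
    κ.eisensteinLocalReduce (fun j ↦ V.torsionGaloisModule ((p : ℤ) ^ j)) t hm v k
        (galoisCohomology.map (DiscreteGaloisModule.localMap (κ.shapiroToEisensteinTwistLe V hm (i + 1) (k + 1) hσ hle) v) 1 y) =
      galoisCohomology.map (DiscreteGaloisModule.localMap (κ.shapiroToEisensteinTwistLe V hm (i + 1) k hσ' hle') v) 1 y := by
  rw [eisensteinLocalReduce]
  exact galoisCohomology.map_map_of_comp_apply
    (DiscreteGaloisModule.localMap (κ.shapiroToEisensteinTwistLe V hm (i + 1) (k + 1) hσ hle) v)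
    (DiscreteGaloisModule.localMap (κ.eisensteinTwistReduce hm (Nat.le_succ k) (t k)) v)
    (DiscreteGaloisModule.localMap (κ.shapiroToEisensteinTwistLe V hm (i + 1) k hσ' hle') v)
    (fun x ↦ (κ.eisensteinTwistReduce_shapiroToEisensteinTwistLe t ht hm (i + 1) k hσ hσ' hle hle' x).symm) y

section Cores

variable {v : HeightOneSpectrum (𝓞 K)}

include ht in
/-- **At `v ∣ p`, shifted tower: `H¹(K_v, f_{i+1,k})` carries the ordinary core of `𝐓_i` for the shifted filtration `Φ.succ`
(`Fil_v E[p^{i+1}] ⊗ Λ/I`) into D1's ordinary core at level `k`.** [cite: Howard2004HeegnerKolyvagin, Def. 2.2.5–2.2.6 and Lemma 2.2.7 (arXiv p0016 L84–148)] [cite: GreenbergLNM1716, §2] -/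
theorem map_localMap_shapiroToEisensteinTwistLe_mem_ordinaryCore_succ
    (Φ : OrdinaryFiltration (fun j ↦ V.torsionGaloisModule ((p : ℤ) ^ j)) t v) (i k : ℕ) (hσ : k ≤ i + 1)
    (hle : shapiroIdeal p (i + 1) ≤ Ideal.span {(PowerSeries.X ^ m + PowerSeries.C (p : ℤ_[p]) : IwasawaAlgebra p)} ⊔
      Ideal.span {PowerSeries.C ((p : ℤ_[p]) ^ k)})
    {c : galoisCohomology (((κ.coeffAdicTower (fun j ↦ V.torsionGaloisModule ((p : ℤ) ^ (j + 1))) (fun j ↦ t (j + 1))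
      (fun j ↦ shapiroIdeal p (j + 1)) (fun j ↦ shapiroIdeal_succ_le p (j + 1)) (fun j ↦ j + 1) (fun j ↦ omega_mem_shapiroIdeal p (j + 1))
      (fun j ↦ (j + 1) * p ^ (j + 1) + (j + 1)) (fun j ↦ maximalIdeal_pow_le_shapiroIdeal p (j + 1)) (fun j ↦ hts (j + 1))).ρ i).toLocal (Sum.inr v)) 1}
    (hc : c ∈ coeffOrdinaryCore (fun j ↦ shapiroIdeal p (j + 1)) (fun j ↦ shapiroIdeal_succ_le p (j + 1)) (fun j ↦ j + 1)
        (fun j ↦ omega_mem_shapiroIdeal p (j + 1)) (fun j ↦ (j + 1) * p ^ (j + 1) + (j + 1)) (fun j ↦ maximalIdeal_pow_le_shapiroIdeal p (j + 1)) (fun j ↦ hts (j + 1)) Φ.succ i) :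
    galoisCohomology.map (DiscreteGaloisModule.localMap (κ.shapiroToEisensteinTwistLe V hm (i + 1) k hσ hle) (Sum.inr v)) 1 c ∈
      Φ.ordinaryCore hm k :=
  DiscreteGaloisModule.map_mem_strictSubgroup
    (DiscreteGaloisModule.localMap (κ.shapiroToEisensteinTwistLe V hm (i + 1) k hσ hle) (Sum.inr v)) _ _ _ _
    (fun _ hw ↦ κ.shapiroToEisensteinTwistLe_mem_twistedFil t ht hm Φ (i + 1) k hσ hle hw) hc

/-- **At any finite place, shifted tower: `H¹(K_v, f_{i+1,k})` carries unramified classes to unramified classes.**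
[cite: Howard2004HeegnerKolyvagin, Def. 1.1.1 and Lemma 1.1.9] [cite: SerreGaloisCohomology1997, I §2.4] -/
theorem map_localMap_shapiroToEisensteinTwistLe_mem_unramifiedSubgroup_succ (i k : ℕ) (hσ : k ≤ i + 1)
    (hle : shapiroIdeal p (i + 1) ≤ Ideal.span {(PowerSeries.X ^ m + PowerSeries.C (p : ℤ_[p]) : IwasawaAlgebra p)} ⊔
      Ideal.span {PowerSeries.C ((p : ℤ_[p]) ^ k)})
    {c : galoisCohomology (((κ.coeffAdicTower (fun j ↦ V.torsionGaloisModule ((p : ℤ) ^ (j + 1))) (fun j ↦ t (j + 1))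
      (fun j ↦ shapiroIdeal p (j + 1)) (fun j ↦ shapiroIdeal_succ_le p (j + 1)) (fun j ↦ j + 1) (fun j ↦ omega_mem_shapiroIdeal p (j + 1))
      (fun j ↦ (j + 1) * p ^ (j + 1) + (j + 1)) (fun j ↦ maximalIdeal_pow_le_shapiroIdeal p (j + 1)) (fun j ↦ hts (j + 1))).ρ i).toLocal (Sum.inr v)) 1}
    (hc : c ∈ DiscreteGaloisModule.unramifiedSubgroup (GaloisRep.toLocal v ((κ.coeffAdicTower (fun j ↦ V.torsionGaloisModule ((p : ℤ) ^ (j + 1))) (fun j ↦ t (j + 1))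
      (fun j ↦ shapiroIdeal p (j + 1)) (fun j ↦ shapiroIdeal_succ_le p (j + 1)) (fun j ↦ j + 1) (fun j ↦ omega_mem_shapiroIdeal p (j + 1))
      (fun j ↦ (j + 1) * p ^ (j + 1) + (j + 1)) (fun j ↦ maximalIdeal_pow_le_shapiroIdeal p (j + 1)) (fun j ↦ hts (j + 1))).ρ i)) 1) :
    galoisCohomology.map (DiscreteGaloisModule.localMap (κ.shapiroToEisensteinTwistLe V hm (i + 1) k hσ hle) (Sum.inr v)) 1 c ∈
      DiscreteGaloisModule.unramifiedSubgroup
        (GaloisRep.toLocal v (κ.eisensteinTwist (V.torsionGaloisModule ((p : ℤ) ^ k)) hm k)) 1 :=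
  DiscreteGaloisModule.map_mem_unramifiedSubgroup _ hc

end Cores

/-! ## §2 Lemma 2.2.7 for the shifted source, place by place and at all places -/

variable (S : Finset (HeightOneSpectrum (𝓞 K)))
  (Φ : ∀ v : HeightOneSpectrum (𝓞 K), ((p : ℕ) : 𝓞 K) ∈ v.asIdeal →
    OrdinaryFiltration (fun j ↦ V.torsionGaloisModule ((p : ℤ) ^ j)) t v)

include ht in
/-- **Lemma 2.2.7 at `v ∣ p`, shifted source**: `H¹(K_v, f_{i+1,k})` carries `𝓕_Λ` (exact condition of the ordinary local tower of
the shifted source for `Φ.succ`, tower level `i`) into `F_𝔮` (saturated strict ordinary condition, level `k`).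
[cite: Howard2004HeegnerKolyvagin, Lemma 2.2.7 and Def. 2.2.6 (arXiv p0016 L104–148)] [cite: CastellaGrossiLeeSkinner2022, §3.4 (arXiv v2 TeX L2102–2108)] -/
theorem map_coeffSelmerStructure_succ_le_eisensteinSelmerStructure_of_mem (i k : ℕ) (hσ : k ≤ i + 1)
    (hle : shapiroIdeal p (i + 1) ≤ Ideal.span {(PowerSeries.X ^ m + PowerSeries.C (p : ℤ_[p]) : IwasawaAlgebra p)} ⊔
      Ideal.span {PowerSeries.C ((p : ℤ_[p]) ^ k)})
    {v : HeightOneSpectrum (𝓞 K)} (hv : ((p : ℕ) : 𝓞 K) ∈ v.asIdeal) :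
    (κ.coeffSelmerStructure (fun j ↦ V.torsionGaloisModule ((p : ℤ) ^ (j + 1))) (fun j ↦ t (j + 1))
        (fun j ↦ shapiroIdeal p (j + 1)) (fun j ↦ shapiroIdeal_succ_le p (j + 1)) (fun j ↦ j + 1) (fun j ↦ omega_mem_shapiroIdeal p (j + 1))
        (fun j ↦ (j + 1) * p ^ (j + 1) + (j + 1)) (fun j ↦ maximalIdeal_pow_le_shapiroIdeal p (j + 1)) (fun j ↦ hts (j + 1)) S (fun v hv ↦ (Φ v hv).succ) i
        (Sum.inr v)).map
      (galoisCohomology.map (DiscreteGaloisModule.localMap (κ.shapiroToEisensteinTwistLe V hm (i + 1) k hσ hle) (Sum.inr v)) 1) ≤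
      κ.eisensteinSelmerStructure (fun j ↦ V.torsionGaloisModule ((p : ℤ) ^ j)) t hm S Φ k (Sum.inr v) := by
  obtain ⟨σ₀, hσ₀⟩ := exists_forall_adm p (m := m) hm
  refine (AddSubgroup.map_mono (κ.coeffSelmerStructure_inr_of_mem (fun j ↦ V.torsionGaloisModule ((p : ℤ) ^ (j + 1))) (fun j ↦ t (j + 1))
        (fun j ↦ shapiroIdeal p (j + 1)) (fun j ↦ shapiroIdeal_succ_le p (j + 1)) (fun j ↦ j + 1) (fun j ↦ omega_mem_shapiroIdeal p (j + 1))
        (fun j ↦ (j + 1) * p ^ (j + 1) + (j + 1)) (fun j ↦ maximalIdeal_pow_le_shapiroIdeal p (j + 1)) (fun j ↦ hts (j + 1)) S (fun v hv ↦ (Φ v hv).succ) i hv).le).trans ?_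
  refine le_trans ?_ (κ.eisensteinSelmerStructure_inr_of_mem (fun j ↦ V.torsionGaloisModule ((p : ℤ) ^ j)) t hm S Φ k hv).ge
  have key : (Tower.exactLevelCondition (κ.coeffLocalRed (fun j ↦ V.torsionGaloisModule ((p : ℤ) ^ (j + 1))) (fun j ↦ t (j + 1))
      (fun j ↦ shapiroIdeal p (j + 1)) (fun j ↦ shapiroIdeal_succ_le p (j + 1)) (fun j ↦ j + 1) (fun j ↦ omega_mem_shapiroIdeal p (j + 1))
      (fun j ↦ (j + 1) * p ^ (j + 1) + (j + 1)) (fun j ↦ maximalIdeal_pow_le_shapiroIdeal p (j + 1)) (fun j ↦ hts (j + 1)) (Sum.inr v))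
      (fun j ↦ coeffOrdinaryCore (fun j ↦ shapiroIdeal p (j + 1)) (fun j ↦ shapiroIdeal_succ_le p (j + 1)) (fun j ↦ j + 1)
        (fun j ↦ omega_mem_shapiroIdeal p (j + 1)) (fun j ↦ (j + 1) * p ^ (j + 1) + (j + 1)) (fun j ↦ maximalIdeal_pow_le_shapiroIdeal p (j + 1)) (fun j ↦ hts (j + 1)) (Φ v hv).succ j) i).map
      (galoisCohomology.map (DiscreteGaloisModule.localMap (κ.shapiroToEisensteinTwistLe V hm (i + 1) k hσ hle) (Sum.inr v)) 1) ≤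
      Tower.levelCondition (κ.eisensteinLocalReduce (fun j ↦ V.torsionGaloisModule ((p : ℤ) ^ j)) t hm (Sum.inr v)) p
        (fun j ↦ (Φ v hv).ordinaryCore hm j) k :=
    Tower.map_exactLevelCondition_le_levelCondition
      (red := κ.coeffLocalRed (fun j ↦ V.torsionGaloisModule ((p : ℤ) ^ (j + 1))) (fun j ↦ t (j + 1))
      (fun j ↦ shapiroIdeal p (j + 1)) (fun j ↦ shapiroIdeal_succ_le p (j + 1)) (fun j ↦ j + 1) (fun j ↦ omega_mem_shapiroIdeal p (j + 1))
      (fun j ↦ (j + 1) * p ^ (j + 1) + (j + 1)) (fun j ↦ maximalIdeal_pow_le_shapiroIdeal p (j + 1)) (fun j ↦ hts (j + 1)) (Sum.inr v))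
      (red' := κ.eisensteinLocalReduce (fun j ↦ V.torsionGaloisModule ((p : ℤ) ^ j)) t hm (Sum.inr v))
      (Adm := fun i k ↦ k ≤ i + 1 ∧ shapiroIdeal p (i + 1) ≤
        Ideal.span {(PowerSeries.X ^ m + PowerSeries.C (p : ℤ_[p]) : IwasawaAlgebra p)} ⊔
          Ideal.span {PowerSeries.C ((p : ℤ_[p]) ^ k)})
      (g := fun i k h ↦ galoisCohomology.map
        (DiscreteGaloisModule.localMap (κ.shapiroToEisensteinTwistLe V hm (i + 1) k h.1 h.2) (Sum.inr v)) 1)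
      (fun i k h ↦ adm_succ_of_adm p m h)
      (fun i k h h' y ↦ (κ.map_localMap_shapiroToEisensteinTwistLe_coeffLocalRed_succ t ht hts hm (Sum.inr v) i k h.1
        h'.1 h.2 h'.2 y).symm)
      (fun i k h h' y ↦ κ.eisensteinLocalReduce_map_localMap_shapiroToEisensteinTwistLe_succ t ht hts hm (Sum.inr v) i k
        h.1 h'.1 h.2 h'.2 y)
      σ₀ (fun k ↦ adm_succ_of_adm p m (hσ₀ k)) p
      (C := fun j ↦ coeffOrdinaryCore (fun j ↦ shapiroIdeal p (j + 1)) (fun j ↦ shapiroIdeal_succ_le p (j + 1)) (fun j ↦ j + 1)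
        (fun j ↦ omega_mem_shapiroIdeal p (j + 1)) (fun j ↦ (j + 1) * p ^ (j + 1) + (j + 1)) (fun j ↦ maximalIdeal_pow_le_shapiroIdeal p (j + 1)) (fun j ↦ hts (j + 1)) (Φ v hv).succ j)
      (C' := fun j ↦ (Φ v hv).ordinaryCore hm j)
      (fun i k h y hy ↦ κ.map_localMap_shapiroToEisensteinTwistLe_mem_ordinaryCore_succ t ht hts hm (Φ v hv) i k h.1 h.2
        hy)
      k ⟨hσ, hle⟩
  exact key

include ht in
/-- **Lemma 2.2.7 at `v ∈ S`, `v ∤ p`, shifted source**: given that `p^c` kills `H¹(K_v, E[p^j] ⊗ A_{m,j}(ψ))` for all `j ≥ 1`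
(the (N1) bound), `H¹(K_v, f_{i+1,k})` carries the exact relaxed condition of the shifted source into the saturated unramified
condition of the target. [cite: Howard2004HeegnerKolyvagin, Lemma 2.2.7 and Def. 2.1.1 (arXiv p. 5, p0016 L142–148)] [cite: CastellaGrossiLeeSkinner2022, §3.4 («H¹(K_w, 𝐓) else»)] -/
theorem map_coeffSelmerStructure_succ_le_eisensteinSelmerStructure_of_mem_of_not_mem (i k : ℕ) (hσ : k ≤ i + 1)
    (hle : shapiroIdeal p (i + 1) ≤ Ideal.span {(PowerSeries.X ^ m + PowerSeries.C (p : ℤ_[p]) : IwasawaAlgebra p)} ⊔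
      Ideal.span {PowerSeries.C ((p : ℤ_[p]) ^ k)})
    {v : HeightOneSpectrum (𝓞 K)} (hv : ((p : ℕ) : 𝓞 K) ∉ v.asIdeal) (hvS : v ∈ S)
    (hN : ∃ c : ℕ, ∀ j, 1 ≤ j → ∀ x : galoisCohomology ((κ.eisensteinTwist (V.torsionGaloisModule ((p : ℤ) ^ j)) hm j).toLocal (Sum.inr v)) 1, p ^ c • x = 0) :
    (κ.coeffSelmerStructure (fun j ↦ V.torsionGaloisModule ((p : ℤ) ^ (j + 1))) (fun j ↦ t (j + 1))
        (fun j ↦ shapiroIdeal p (j + 1)) (fun j ↦ shapiroIdeal_succ_le p (j + 1)) (fun j ↦ j + 1) (fun j ↦ omega_mem_shapiroIdeal p (j + 1))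
        (fun j ↦ (j + 1) * p ^ (j + 1) + (j + 1)) (fun j ↦ maximalIdeal_pow_le_shapiroIdeal p (j + 1)) (fun j ↦ hts (j + 1)) S (fun v hv ↦ (Φ v hv).succ) i
        (Sum.inr v)).map
      (galoisCohomology.map (DiscreteGaloisModule.localMap (κ.shapiroToEisensteinTwistLe V hm (i + 1) k hσ hle) (Sum.inr v)) 1) ≤
      κ.eisensteinSelmerStructure (fun j ↦ V.torsionGaloisModule ((p : ℤ) ^ j)) t hm S Φ k (Sum.inr v) := by
  obtain ⟨σ₀, hσ₀⟩ := exists_forall_adm p (m := m) hm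
  obtain ⟨c, hc⟩ := hN
  refine (AddSubgroup.map_mono (κ.coeffSelmerStructure_inr_of_mem_of_not_mem (fun j ↦ V.torsionGaloisModule ((p : ℤ) ^ (j + 1))) (fun j ↦ t (j + 1))
        (fun j ↦ shapiroIdeal p (j + 1)) (fun j ↦ shapiroIdeal_succ_le p (j + 1)) (fun j ↦ j + 1) (fun j ↦ omega_mem_shapiroIdeal p (j + 1))
        (fun j ↦ (j + 1) * p ^ (j + 1) + (j + 1)) (fun j ↦ maximalIdeal_pow_le_shapiroIdeal p (j + 1)) (fun j ↦ hts (j + 1)) S (fun v hv ↦ (Φ v hv).succ) i hv hvS).le).trans ?_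
  refine le_trans ?_ (κ.eisensteinSelmerStructure_inr_of_mem_of_not_mem (fun j ↦ V.torsionGaloisModule ((p : ℤ) ^ j)) t
    hm S Φ k hv hvS).ge
  have key : (Tower.exactLevelCondition (κ.coeffLocalRed (fun j ↦ V.torsionGaloisModule ((p : ℤ) ^ (j + 1))) (fun j ↦ t (j + 1))
      (fun j ↦ shapiroIdeal p (j + 1)) (fun j ↦ shapiroIdeal_succ_le p (j + 1)) (fun j ↦ j + 1) (fun j ↦ omega_mem_shapiroIdeal p (j + 1))
      (fun j ↦ (j + 1) * p ^ (j + 1) + (j + 1)) (fun j ↦ maximalIdeal_pow_le_shapiroIdeal p (j + 1)) (fun j ↦ hts (j + 1)) (Sum.inr v))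
      (fun j ↦ (⊤ : AddSubgroup (galoisCohomology (((κ.coeffAdicTower (fun j ↦ V.torsionGaloisModule ((p : ℤ) ^ (j + 1))) (fun j ↦ t (j + 1))
      (fun j ↦ shapiroIdeal p (j + 1)) (fun j ↦ shapiroIdeal_succ_le p (j + 1)) (fun j ↦ j + 1) (fun j ↦ omega_mem_shapiroIdeal p (j + 1))
      (fun j ↦ (j + 1) * p ^ (j + 1) + (j + 1)) (fun j ↦ maximalIdeal_pow_le_shapiroIdeal p (j + 1)) (fun j ↦ hts (j + 1))).ρ j).toLocal (Sum.inr v)) 1))) i).map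
      (galoisCohomology.map (DiscreteGaloisModule.localMap (κ.shapiroToEisensteinTwistLe V hm (i + 1) k hσ hle) (Sum.inr v)) 1) ≤
      Tower.levelCondition (κ.eisensteinLocalReduce (fun j ↦ V.torsionGaloisModule ((p : ℤ) ^ j)) t hm (Sum.inr v)) p
        (fun j ↦ DiscreteGaloisModule.unramifiedSubgroup
          (GaloisRep.toLocal v (κ.eisensteinTwist (V.torsionGaloisModule ((p : ℤ) ^ j)) hm j)) 1) k :=
    Tower.map_exactLevelCondition_le_levelCondition_of_forall_nsmul_eq_zero
      (H' := fun j ↦ galoisCohomology ((κ.eisensteinTwist (V.torsionGaloisModule ((p : ℤ) ^ j)) hm j).toLocal (Sum.inr v)) 1)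
      (red := κ.coeffLocalRed (fun j ↦ V.torsionGaloisModule ((p : ℤ) ^ (j + 1))) (fun j ↦ t (j + 1))
      (fun j ↦ shapiroIdeal p (j + 1)) (fun j ↦ shapiroIdeal_succ_le p (j + 1)) (fun j ↦ j + 1) (fun j ↦ omega_mem_shapiroIdeal p (j + 1))
      (fun j ↦ (j + 1) * p ^ (j + 1) + (j + 1)) (fun j ↦ maximalIdeal_pow_le_shapiroIdeal p (j + 1)) (fun j ↦ hts (j + 1)) (Sum.inr v))
      (red' := κ.eisensteinLocalReduce (fun j ↦ V.torsionGaloisModule ((p : ℤ) ^ j)) t hm (Sum.inr v))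
      (Adm := fun i k ↦ k ≤ i + 1 ∧ shapiroIdeal p (i + 1) ≤
        Ideal.span {(PowerSeries.X ^ m + PowerSeries.C (p : ℤ_[p]) : IwasawaAlgebra p)} ⊔
          Ideal.span {PowerSeries.C ((p : ℤ_[p]) ^ k)})
      (g := fun i k h ↦ galoisCohomology.map
        (DiscreteGaloisModule.localMap (κ.shapiroToEisensteinTwistLe V hm (i + 1) k h.1 h.2) (Sum.inr v)) 1)
      (fun i k h ↦ adm_succ_of_adm p m h)
      (fun i k h h' y ↦ (κ.map_localMap_shapiroToEisensteinTwistLe_coeffLocalRed_succ t ht hts hm (Sum.inr v) i k h.1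
        h'.1 h.2 h'.2 y).symm)
      (fun i k h h' y ↦ κ.eisensteinLocalReduce_map_localMap_shapiroToEisensteinTwistLe_succ t ht hts hm (Sum.inr v) i k
        h.1 h'.1 h.2 h'.2 y)
      σ₀ (fun k ↦ adm_succ_of_adm p m (hσ₀ k)) p c
      (fun y hy j ↦ κ.forall_pow_smul_eq_zero_of_mem_compatibleFamilies t hm (Sum.inr v) hc hy j)
      (C := fun j ↦ (⊤ : AddSubgroup (galoisCohomology (((κ.coeffAdicTower (fun j ↦ V.torsionGaloisModule ((p : ℤ) ^ (j + 1))) (fun j ↦ t (j + 1))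
      (fun j ↦ shapiroIdeal p (j + 1)) (fun j ↦ shapiroIdeal_succ_le p (j + 1)) (fun j ↦ j + 1) (fun j ↦ omega_mem_shapiroIdeal p (j + 1))
      (fun j ↦ (j + 1) * p ^ (j + 1) + (j + 1)) (fun j ↦ maximalIdeal_pow_le_shapiroIdeal p (j + 1)) (fun j ↦ hts (j + 1))).ρ j).toLocal (Sum.inr v)) 1)))
      (C' := fun j ↦ DiscreteGaloisModule.unramifiedSubgroup
          (GaloisRep.toLocal v (κ.eisensteinTwist (V.torsionGaloisModule ((p : ℤ) ^ j)) hm j)) 1)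
      k ⟨hσ, hle⟩
  exact key

/-- **Outside `S ∪ {v ∣ p}`, shifted source**: `H¹(K_v, f_{i+1,k})` carries `H¹_ur` into `H¹_ur`.
[cite: Howard2004HeegnerKolyvagin, Def. 1.1.1, Lemma 1.1.9 and Def. 2.2.6 (arXiv pp. 5, 16)] -/
theorem map_coeffSelmerStructure_succ_le_eisensteinSelmerStructure_of_not_mem (i k : ℕ) (hσ : k ≤ i + 1)
    (hle : shapiroIdeal p (i + 1) ≤ Ideal.span {(PowerSeries.X ^ m + PowerSeries.C (p : ℤ_[p]) : IwasawaAlgebra p)} ⊔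
      Ideal.span {PowerSeries.C ((p : ℤ_[p]) ^ k)})
    {v : HeightOneSpectrum (𝓞 K)} (hv : ((p : ℕ) : 𝓞 K) ∉ v.asIdeal) (hvS : v ∉ S) :
    (κ.coeffSelmerStructure (fun j ↦ V.torsionGaloisModule ((p : ℤ) ^ (j + 1))) (fun j ↦ t (j + 1))
        (fun j ↦ shapiroIdeal p (j + 1)) (fun j ↦ shapiroIdeal_succ_le p (j + 1)) (fun j ↦ j + 1) (fun j ↦ omega_mem_shapiroIdeal p (j + 1))
        (fun j ↦ (j + 1) * p ^ (j + 1) + (j + 1)) (fun j ↦ maximalIdeal_pow_le_shapiroIdeal p (j + 1)) (fun j ↦ hts (j + 1)) S (fun v hv ↦ (Φ v hv).succ) i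
        (Sum.inr v)).map
      (galoisCohomology.map (DiscreteGaloisModule.localMap (κ.shapiroToEisensteinTwistLe V hm (i + 1) k hσ hle) (Sum.inr v)) 1) ≤
      κ.eisensteinSelmerStructure (fun j ↦ V.torsionGaloisModule ((p : ℤ) ^ j)) t hm S Φ k (Sum.inr v) := by
  rintro _ ⟨c, hc, rfl⟩
  exact (κ.eisensteinSelmerStructure_inr_of_not_mem (fun j ↦ V.torsionGaloisModule ((p : ℤ) ^ j)) t hm S Φ k hv hvS).ge
    (κ.map_localMap_shapiroToEisensteinTwistLe_mem_unramifiedSubgroup_succ t hts hm i k hσ hle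
      ((κ.coeffSelmerStructure_inr_of_not_mem (fun j ↦ V.torsionGaloisModule ((p : ℤ) ^ (j + 1))) (fun j ↦ t (j + 1))
        (fun j ↦ shapiroIdeal p (j + 1)) (fun j ↦ shapiroIdeal_succ_le p (j + 1)) (fun j ↦ j + 1) (fun j ↦ omega_mem_shapiroIdeal p (j + 1))
        (fun j ↦ (j + 1) * p ^ (j + 1) + (j + 1)) (fun j ↦ maximalIdeal_pow_le_shapiroIdeal p (j + 1)) (fun j ↦ hts (j + 1)) S (fun v hv ↦ (Φ v hv).succ) i hv hvS).le hc))

include ht in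
/-- **Howard's Lemma 2.2.7 for lit's shifted source, all places**: for `k ≤ i+1` and `(ω_{i+1}, p^{i+1}) ≤ (q_m, p^k)`, the SAME
`S ⊇ {v ∣ p}` on both sides, ordinary data `Φ.succ` (source) / `Φ` (target), and the (N1) torsion bound at `S ∖ {p}`,
`H¹(K_v, f_{i+1,k})` carries `𝓕_Λ` at tower level `i` into `F_𝔮` at level `k` at every place `v`.
[cite: Howard2004HeegnerKolyvagin, Lemma 2.2.7, Rem. 1.2.4 and proof of Thm. 2.2.10 (arXiv p. 7 L13–27, p0016 L142–148, p0017 L78–81)] -/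
theorem map_coeffSelmerStructure_succ_le_eisensteinSelmerStructure (i k : ℕ) (hσ : k ≤ i + 1)
    (hle : shapiroIdeal p (i + 1) ≤ Ideal.span {(PowerSeries.X ^ m + PowerSeries.C (p : ℤ_[p]) : IwasawaAlgebra p)} ⊔
      Ideal.span {PowerSeries.C ((p : ℤ_[p]) ^ k)})
    (hS : ∀ v ∈ S, ((p : ℕ) : 𝓞 K) ∉ v.asIdeal → ∃ c : ℕ, ∀ j, 1 ≤ j → ∀ x : galoisCohomology ((κ.eisensteinTwist (V.torsionGaloisModule ((p : ℤ) ^ j)) hm j).toLocal (Sum.inr v)) 1, p ^ c • x = 0)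
    (v : NumberField.Place K) :
    (κ.coeffSelmerStructure (fun j ↦ V.torsionGaloisModule ((p : ℤ) ^ (j + 1))) (fun j ↦ t (j + 1))
        (fun j ↦ shapiroIdeal p (j + 1)) (fun j ↦ shapiroIdeal_succ_le p (j + 1)) (fun j ↦ j + 1) (fun j ↦ omega_mem_shapiroIdeal p (j + 1))
        (fun j ↦ (j + 1) * p ^ (j + 1) + (j + 1)) (fun j ↦ maximalIdeal_pow_le_shapiroIdeal p (j + 1)) (fun j ↦ hts (j + 1)) S (fun v hv ↦ (Φ v hv).succ) i
        v).map
      (galoisCohomology.map (DiscreteGaloisModule.localMap (κ.shapiroToEisensteinTwistLe V hm (i + 1) k hσ hle) v) 1) ≤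
      κ.eisensteinSelmerStructure (fun j ↦ V.torsionGaloisModule ((p : ℤ) ^ j)) t hm S Φ k v := by
  rcases v with w | v
  · exact le_of_le_of_eq le_top
      (κ.eisensteinSelmerStructure_inl (fun j ↦ V.torsionGaloisModule ((p : ℤ) ^ j)) t hm S Φ k w).symm
  · by_cases hv : ((p : ℕ) : 𝓞 K) ∈ v.asIdeal
    · exact κ.map_coeffSelmerStructure_succ_le_eisensteinSelmerStructure_of_mem t ht hts hm S Φ i k hσ hle hv
    · by_cases hvS : v ∈ S
      · exact κ.map_coeffSelmerStructure_succ_le_eisensteinSelmerStructure_of_mem_of_not_mem t ht hts hm S Φ i k hσ hle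
          hv hvS (hS v hvS hv)
      · exact κ.map_coeffSelmerStructure_succ_le_eisensteinSelmerStructure_of_not_mem t hts hm S Φ i k hσ hle hv hvS

/-! ## §3 Bridge to the `ContinuousRep.cohomologyMap` spelling of `Hom.cond_le` on the shifted level synonym -/

omit [NumberField K] in
/-- On the shifted level synonym the local `ContinuousRep.cohomologyMap` of the additive level map
`shapiroToEisensteinLevelMap (i+1) k` (any equivariance proof) IS `galoisCohomology.map (localMap (shapiroToEisensteinTwistLe (i+1) k …) v) 1`.
[cite: SerreGaloisCohomology1997, I §2.2 and II §6.1] [cite: Howard2004HeegnerKolyvagin, Rem. 1.2.4 (iii)] -/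
theorem cohomologyMap_toLocal_shapiroToEisensteinLevelMap_succ_eq [NumberField K] (v : NumberField.Place K) (i k : ℕ)
    (hσ : k ≤ i + 1)
    (hle : shapiroIdeal p (i + 1) ≤ Ideal.span {(PowerSeries.X ^ m + PowerSeries.C (p : ℤ_[p]) : IwasawaAlgebra p)} ⊔
      Ideal.span {PowerSeries.C ((p : ℤ_[p]) ^ k)})
    (h : ∀ (g : absoluteGaloisGroup (NumberField.Place.Completion v))
      (x : CoeffLevel p (fun j ↦ shapiroIdeal p (j + 1))
        (fun j ↦ WeierstrassCurve.geomTorsion V ((p : ℤ) ^ (j + 1))) i),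
      κ.shapiroToEisensteinLevelMap V hm (i + 1) k hσ hle ((((κ.coeffAdicTower (fun j ↦ V.torsionGaloisModule ((p : ℤ) ^ (j + 1))) (fun j ↦ t (j + 1))
      (fun j ↦ shapiroIdeal p (j + 1)) (fun j ↦ shapiroIdeal_succ_le p (j + 1)) (fun j ↦ j + 1) (fun j ↦ omega_mem_shapiroIdeal p (j + 1))
      (fun j ↦ (j + 1) * p ^ (j + 1) + (j + 1)) (fun j ↦ maximalIdeal_pow_le_shapiroIdeal p (j + 1)) (fun j ↦ hts (j + 1))).ρ i).toLocal v) g x) =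
        (((κ.eisensteinTwist (V.torsionGaloisModule ((p : ℤ) ^ k)) hm k :
          ContinuousRep (absoluteGaloisGroup K) ℤ
            (EisensteinLevel p m (fun j ↦ WeierstrassCurve.geomTorsion V ((p : ℤ) ^ j)) k))).toLocal v) g
          (κ.shapiroToEisensteinLevelMap V hm (i + 1) k hσ hle x)) :
    ContinuousRep.cohomologyMap (((κ.coeffAdicTower (fun j ↦ V.torsionGaloisModule ((p : ℤ) ^ (j + 1))) (fun j ↦ t (j + 1))
      (fun j ↦ shapiroIdeal p (j + 1)) (fun j ↦ shapiroIdeal_succ_le p (j + 1)) (fun j ↦ j + 1) (fun j ↦ omega_mem_shapiroIdeal p (j + 1))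
      (fun j ↦ (j + 1) * p ^ (j + 1) + (j + 1)) (fun j ↦ maximalIdeal_pow_le_shapiroIdeal p (j + 1)) (fun j ↦ hts (j + 1))).ρ i).toLocal v)
        (((κ.eisensteinTwist (V.torsionGaloisModule ((p : ℤ) ^ k)) hm k :
          ContinuousRep (absoluteGaloisGroup K) ℤ
            (EisensteinLevel p m (fun j ↦ WeierstrassCurve.geomTorsion V ((p : ℤ) ^ j)) k))).toLocal v)
        (κ.shapiroToEisensteinLevelMap V hm (i + 1) k hσ hle) continuous_of_discreteTopology h 1 =
      galoisCohomology.map (DiscreteGaloisModule.localMap (κ.shapiroToEisensteinTwistLe V hm (i + 1) k hσ hle) v) 1 := by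
  refine AddMonoidHom.ext fun y ↦ ?_
  obtain ⟨φ, rfl⟩ := oneCocycleClass_surjective _ y
  change ContinuousCohomology.map _ _ 1 _ = ContinuousCohomology.map _ _ 1 _
  erw [map_oneCocycleClass]

end Literature.NumberTheory.EllipticCurves.ZpExtension

end
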